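import Mathlib
import Summits.KontsevichZagierPeriods.KontsevichZagierPeriods.Theses.HardSphereVirial
import Summits.KontsevichZagierPeriods.KontsevichZagierPeriods.Theorems.BetaCancellation.Negative.Torsion

/-!
# Line `argmax_scaling` for crux `StarFourDisc` (stmt-KontsevichZagierPeriods-10456, route HardSphereVirial)

Crux-strategist skeleton = the TYPED DECOMPOSITION of the disc-star chain along the architecture of the PROVED value
computation `Literature.MathematicalPhysics.StatisticalMechanics.HardDiscB4Volume` (`volume_hardDiscStar_toReal`:
argmax decomposition by the largest bond, the scaling `r₂ ↦ (r₂, r₂·y, r₂·z)`, `V(K₄) = 2π·vol Std`, `Std = L×L ∖ Far`).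
The three stub propositions are VERBATIM the three route items filed by the strategist (stmt-17842 `StarDiscScaling`,
stmt-17844 `LensSquareMoment`, stmt-17845 `FarPairMoment`; product-free cylinder convention of the route), so a proof
of a stub closes the item and conversely:

* `StarDiscScaling`  — `[K₄] − 6·[B̄ × L × L, |p|⁴] + 6·[B̄ × Far, |p|⁴] ∈ relations` (∃-form: honest cylinders exist);
* `LensSquareMoment` — `108·[B̄ × L × L, |p|⁴] − 16·[π]³ + 24·[√3][π]² − 27·[π] ∈ relations`;
* `FarPairMoment`    — `108·[B̄ × Far, |p|⁴] + 2·[π]³ − 3·[√3][π]² − 9·[π] ∈ relations`.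

Composition `StarFourDisc_of` (kernel-checked, no sorry): `18·scaling + lens² − far = 9·(2[r] − 2[p] + 3[s] − 2[d])`
in the free abelian group (`module`), then torsion-freeness of `FormalRep ⧸ relations`
(`BetaCancellationNegative.zsmul_mem_relations_iff`). Each stub gets its own skeleton (Lines/scaling.lean,
Lines/lens_square.lean, Lines/far_pairs.lean).
-/

namespace Summit.KontsevichZagierPeriods.KontsevichZagierPeriods.Cruxes.StarFourDisc.ArgmaxScaling

open Literature.NumberTheory.Transcendental

/-- Stub proposition 1 — ARGMAX–SCALING REDUCTION (= route item `StarDiscScaling`, stmt-KontsevichZagierPeriods-17842).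
[cite: KontsevichZagier2001, §1.2] -/
def StarDiscScaling : Prop :=
  ∀ (r : Literature.NumberTheory.Transcendental.KZ.IntegralRep 6), r.domain = {x | x 0 ^ 2 + x 1 ^ 2 < 1 ∧ x 2 ^ 2 + x 3 ^ 2 < 1 ∧ x 4 ^ 2 + x 5 ^ 2 < 1 ∧ (x 0 - x 2) ^ 2 + (x 1 - x 3) ^ 2 < 1 ∧ (x 0 - x 4) ^ 2 + (x 1 - x 5) ^ 2 < 1 ∧ (x 2 - x 4) ^ 2 + (x 3 - x 5) ^ 2 < 1} → (∀ x ∈ r.domain, r.integrand x = 1) → ∃ (qL qF : Literature.NumberTheory.Transcendental.KZ.IntegralRep 6), qL.domain = {x | x 0 ^ 2 + x 1 ^ 2 ≤ 1 ∧ (x 2 ^ 2 + x 3 ^ 2 < 1 ∧ (x 2 - 1) ^ 2 + x 3 ^ 2 < 1) ∧ (x 4 ^ 2 + x 5 ^ 2 < 1 ∧ (x 4 - 1) ^ 2 + x 5 ^ 2 < 1)} ∧ (∀ x ∈ qL.domain, qL.integrand x = (x 0 ^ 2 + x 1 ^ 2) ^ 2) ∧ qF.domain = {x | x 0 ^ 2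 + x 1 ^ 2 ≤ 1 ∧ (x 2 ^ 2 + x 3 ^ 2 < 1 ∧ (x 2 - 1) ^ 2 + x 3 ^ 2 < 1) ∧ (x 4 ^ 2 + x 5 ^ 2 < 1 ∧ (x 4 - 1) ^ 2 + x 5 ^ 2 < 1) ∧ 1 ≤ (x 2 - x 4) ^ 2 + (x 3 - x 5) ^ 2} ∧ (∀ x ∈ qF.domain, qF.integrand x = (x 0 ^ 2 + x 1 ^ 2) ^ 2) ∧ Literature.NumberTheory.Transcendental.KZ.of r - (6 : ℤ) • Literature.NumberTheory.Transcendental.KZ.of qL + (6 : ℤ) • Literature.NumberTheory.Transcendental.KZ.of qF ∈ Literature.NumberTheory.Transcendental.KZ.relations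

/-- Stub proposition 2 — THE LENS-SQUARE QUARTIC MOMENT COMPILES (= route item `LensSquareMoment`,
stmt-KontsevichZagierPeriods-17844). [cite: KontsevichZagier2001, §1.2] -/
def LensSquareMoment : Prop :=
  ∀ (qL : Literature.NumberTheory.Transcendental.KZ.IntegralRep 6), qL.domain = {x | x 0 ^ 2 + x 1 ^ 2 ≤ 1 ∧ (x 2 ^ 2 + x 3 ^ 2 < 1 ∧ (x 2 - 1) ^ 2 + x 3 ^ 2 < 1) ∧ (x 4 ^ 2 + x 5 ^ 2 < 1 ∧ (x 4 - 1) ^ 2 + x 5 ^ 2 < 1)} → (∀ x ∈ qL.domain, qL.integrand x = (x 0 ^ 2 + x 1 ^ 2) ^ 2) → ∀ (p : Literature.NumberTheory.Transcendental.KZ.IntegralRep 6), p.domain = {y | y 0 ^ 2 + y 1 ^ 2 ≤ 1 ∧ y 2 ^ 2 + y 3 ^ 2 ≤ 1 ∧ y 4 ^ 2 + y 5 ^ 2 ≤ 1} → (∀ y ∈ p.domain, p.integrand y = 1) → ∀ (s : Literature.NumberTheory.Transcendental.KZ.IntegralRep 5), s.domain = {y | (0 < y 0 ∧ y 0 ^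 2 < 3) ∧ y 1 ^ 2 + y 2 ^ 2 ≤ 1 ∧ y 3 ^ 2 + y 4 ^ 2 ≤ 1} → (∀ y ∈ s.domain, s.integrand y = 1) → ∀ (d : Literature.NumberTheory.Transcendental.KZ.IntegralRep 2), d.domain = {y | y 0 ^ 2 + y 1 ^ 2 ≤ 1} → (∀ y ∈ d.domain, d.integrand y = 1) → (108 : ℤ) • Literature.NumberTheory.Transcendental.KZ.of qL - (16 : ℤ) • Literature.NumberTheory.Transcendental.KZ.of p + (24 : ℤ) • Literature.NumberTheory.Transcendental.KZ.of s - (27 : ℤ) • Literature.NumberTheory.Transcendental.KZ.of d ∈ Literature.NumberTheory.Transcendental.KZ.relations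

/-- Stub proposition 3 — THE FAR-PAIR DEFECT COMPILES (= route item `FarPairMoment`, stmt-KontsevichZagierPeriods-17845).
[cite: KontsevichZagier2001, §1.2] -/
def FarPairMoment : Prop :=
  ∀ (qF : Literature.NumberTheory.Transcendental.KZ.IntegralRep 6), qF.domain = {x | x 0 ^ 2 + x 1 ^ 2 ≤ 1 ∧ (x 2 ^ 2 + x 3 ^ 2 < 1 ∧ (x 2 - 1) ^ 2 + x 3 ^ 2 < 1) ∧ (x 4 ^ 2 + x 5 ^ 2 < 1 ∧ (x 4 - 1) ^ 2 + x 5 ^ 2 < 1) ∧ 1 ≤ (x 2 - x 4) ^ 2 + (x 3 - x 5) ^ 2} → (∀ x ∈ qF.domain, qF.integrand x = (x 0 ^ 2 + x 1 ^ 2) ^ 2) → ∀ (p : Literature.NumberTheory.Transcendental.KZ.IntegralRep 6), p.domain = {y | y 0 ^ 2 + y 1 ^ 2 ≤ 1 ∧ y 2 ^ 2 + y 3 ^ 2 ≤ 1 ∧ y 4 ^ 2 + y 5 ^ 2 ≤ 1} → (∀ y ∈ p.domain, p.integrand y = 1) → ∀ (s : Literature.NumberTheory.Transcendental.KZ.IntegralRep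 5), s.domain = {y | (0 < y 0 ∧ y 0 ^ 2 < 3) ∧ y 1 ^ 2 + y 2 ^ 2 ≤ 1 ∧ y 3 ^ 2 + y 4 ^ 2 ≤ 1} → (∀ y ∈ s.domain, s.integrand y = 1) → ∀ (d : Literature.NumberTheory.Transcendental.KZ.IntegralRep 2), d.domain = {y | y 0 ^ 2 + y 1 ^ 2 ≤ 1} → (∀ y ∈ d.domain, d.integrand y = 1) → (108 : ℤ) • Literature.NumberTheory.Transcendental.KZ.of qF + (2 : ℤ) • Literature.NumberTheory.Transcendental.KZ.of p - (3 : ℤ) • Literature.NumberTheory.Transcendental.KZ.of s - (9 : ℤ) • Literature.NumberTheory.Transcendental.KZ.of d ∈ Literature.NumberTheory.Transcendental.KZ.relations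

/-- **Stub 1** — six argmax pieces (rule 1a, null ties), five relabelling symmetries (rule 2, `|det| = 1`), ONE scaling chart
`(p,y,z) ↦ (p,p·y,p·z)` (rule 2, Jacobian `|p|⁴`), `Std = L×L ∖ Far` (rule 1a); skeleton Lines/scaling.lean.
[cite: KontsevichZagier2001, §1.2] -/
theorem stub_starDiscScaling : StarDiscScaling := by
  sorry

/-- **Stub 2** — product class + radial moment `∫|p|⁴ = π/3` + the lens chain `6[L] ≡ 4[disc] − 3[(0,√3)]` (conic bands,
genus-zero sector); skeleton Lines/lens_square.lean. [cite: KontsevichZagier2001, §1.2] -/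
theorem stub_lensSquareMoment : LensSquareMoment := by
  sorry

/-- **Stub 3** — slicing to `[Ω, (m + m′ − c)²]`, the swap symmetry kills the antisymmetric part, genus-zero sector +
unfolded cross terms for the symmetric part; skeleton Lines/far_pairs.lean. [cite: KontsevichZagier2001, §1.2] -/
theorem stub_farPairMoment : FarPairMoment := by
  sorry

/-- **Composition**: the three stubs imply the crux `StarFourDisc` BY NAME — `18·scaling + lens² − far = 9·star` in the free
abelian group (`module`), then torsion-freeness of `FormalRep ⧸ relations`. No hypotheses: the registered stubs are used by
name. [cite: KontsevichZagier2001, §1.2] -/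
theorem StarFourDisc_of :
    Summit.KontsevichZagierPeriods.KontsevichZagierPeriods.Theses.HardSphereVirial.StarFourDisc := by
  intro r hr hr1 p hp hp1 s hs hs1 d hd hd1
  obtain ⟨qL, qF, hqL, hqL1, hqF, hqF1, hrel⟩ := stub_starDiscScaling r hr hr1
  have hL := stub_lensSquareMoment qL hqL hqL1 p hp hp1 s hs hs1 d hd hd1
  have hF := stub_farPairMoment qF hqF hqF1 p hp hp1 s hs hs1 d hd hd1
  have h9 : (9 : ℤ) • ((2 : ℤ) • KZ.of r - (2 : ℤ) • KZ.of p + (3 : ℤ) • KZ.of s - (2 : ℤ) • KZ.of d) ∈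
      KZ.relations := by
    have hsum := KZ.relations.sub_mem (KZ.relations.add_mem (KZ.relations.zsmul_mem hrel 18) hL) hF
    convert hsum using 1
    module
  exact (Summit.KontsevichZagierPeriods.KontsevichZagierPeriods.BetaCancellationNegative.zsmul_mem_relations_iff
    (by norm_num) _).1 h9

end Summit.KontsevichZagierPeriods.KontsevichZagierPeriods.Cruxes.StarFourDisc.ArgmaxScaling
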